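import Summits.MatrixMultiplication.OmegaCensus.EisPhaseBlocks
import Summits.MatrixMultiplication.OmegaCensus.PhaseArcClassBox

/-!
# ω-census, family (b3): conjecture C9 — the Eisenstein groups `𝔽_p[ω] ⋊ C₃`: exact errors, class data and the decidable CLASS CHECK

HONEST FRAMING (pub-omega census; verbatim): lottery ticket; floor = certified bounds/negative ranges.
Census BOOKKEEPING (conjecture C9 of the cell; pub-omega stpp-1 gen 21).  For `EisCyc p = 𝔽_p[ω] ⋊_ω ℤ/3` (the Schmidt atom
`𝔽_{p²} ⋊ C₃` when `p ≡ 2 (mod 3)`) take the dihedral-type box `Y = {1, a^α, b}`, `W = {1, a^β, b^t}` with `α = 1/8 ∈ 𝔽_p` and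
`β = κ/8`, `κ = m + nω`.  Then EVERY product `ω^s α`, `ω^s β` is `(g_R + g_I ω)/8` with explicit small integers `g`
(`gαR, gαI, gβR, gβI`: coordinates of `ω^s`, `ω^s κ`; `act_w_mul`), so its coordinates have ERROR exactly `g` and PHASE
`≡ −p·g (mod 8)` (`eight_val_div`, `phase_residue`: `8·val = a p + g`, `p² ≡ 1`): no Thue step, no `√p`.  The error of a column
pair in a coordinate is the exact integer `E = lin t g_α g_β` (`ClassDataE.ER/EI`) and its phase shift is `≡ −p̄ E (mod 8)`.
CLASS = `p mod 8`.  `ClassDataE` / `ClassOKE r` (decidable): box, 2-D phase pattern `P ⊆ (ℤ/8)²` per column, exact trims,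
`|E| ≤ 3`; for every pair of columns/phases the 1-D pair condition holds in the real OR the imaginary coordinate (`PairBarE`).
The theorems using it are in `EisUniform.lean`.  Nothing here is progress on `ω`.
-/

namespace Summit.MatrixMultiplication.OmegaCensus

open Finset

namespace EisArcs

open PhaseArcs (lin col map_lin)

/-- Coordinates of `ω^s` (real part): `ω⁰ = 1`, `ω¹ = ω`, `ω² = −1 − ω`. [folklore] -/
def gαR : ZMod 3 → ℤ := fun s => (![1, 0, -1] : Fin 3 → ℤ) s
/-- Coordinates of `ω^s` (imaginary part). [folklore] -/
def gαI : ZMod 3 → ℤ := fun s => (![0, 1, -1] : Fin 3 → ℤ) s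
/-- Coordinates of `ω^s (m + nω)` (real part). [folklore] -/
def gβR (m n : ℤ) : ZMod 3 → ℤ := fun s => (![m, -n, n - m] : Fin 3 → ℤ) s
/-- Coordinates of `ω^s (m + nω)` (imaginary part). [folklore] -/
def gβI (m n : ℤ) : ZMod 3 → ℤ := fun s => (![n, m - n, -m] : Fin 3 → ℤ) s

/-- A 2-D trim table as an association list `(column, phase pair, trim)`; absent entries are `0`. [folklore] -/
def trimOf2 : List ((Fin 3 × Fin 3) × (ℤ × ℤ) × ℕ) → Fin 3 × Fin 3 → ℤ × ℤ → ℕ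
  | [], _, _ => 0
  | (c', φ', v) :: L, c, φ => if c' = c ∧ φ' = φ then v else trimOf2 L c φ

/-- Class data for the Eisenstein family: `κ = m + nω`, `t`, the 2-D phase pattern and the four exact trim tables. [folklore] -/
structure ClassDataE where
  /-- `κ = m + nω` -/
  m : ℤ
  /-- `κ = m + nω` -/
  n : ℤ
  /-- the `b`-exponent of the third `W`-element -/
  t : ZMod 3
  /-- phase pairs used per column (subsets of `[0,8)²`) -/
  P : Fin 3 × Fin 3 → Finset (ℤ × ℤ)
  /-- bottom trims, real coordinate -/
  lo₁ : Fin 3 × Fin 3 → ℤ × ℤ → ℕ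
  /-- top trims, real coordinate -/
  hi₁ : Fin 3 × Fin 3 → ℤ × ℤ → ℕ
  /-- bottom trims, imaginary coordinate -/
  lo₂ : Fin 3 × Fin 3 → ℤ × ℤ → ℕ
  /-- top trims, imaginary coordinate -/
  hi₂ : Fin 3 × Fin 3 → ℤ × ℤ → ℕ

namespace ClassDataE

variable (cd : ClassDataE)

/-- Number of phase blocks used. [folklore] -/
def MIS : ℕ := ∑ c, #(cd.P c)

/-- Total trim `Σ (lo₁ + hi₁ + lo₂ + hi₂)` (in eighths). [folklore] -/
def SigT : ℕ := ∑ c, ∑ φ ∈ cd.P c, (cd.lo₁ c φ + cd.hi₁ c φ + cd.lo₂ c φ + cd.hi₂ c φ)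

/-- Exact error of the column pair in the real coordinate. [folklore] -/
def ER (c c' : Fin 3 × Fin 3) : ℤ := lin cd.t gαR (gβR cd.m cd.n) c c'

/-- Exact error of the column pair in the imaginary coordinate. [folklore] -/
def EI (c c' : Fin 3 × Fin 3) : ℤ := lin cd.t gαI (gβI cd.m cd.n) c c'

/-- `PairOK` of one coordinate with `Φ` replaced by a residue representative `Φv` and without the size clause. [folklore] -/
def OKc (Φv E φ φ' : ℤ) (lo hi lo' hi' : ℕ) : Prop :=
  (φ - φ' - Φv) % 8 ≠ 0 ∧ ((φ - φ' - Φv - 1) % 8 = 0 → 0 < E → E ≤ hi' ∨ E ≤ lo) ∧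
    ((φ - φ' - Φv + 1) % 8 = 0 → E < 0 → -E ≤ lo' ∨ -E ≤ hi)

/-- `OKc` is decidable. [folklore] -/
instance (Φv E φ φ' : ℤ) (lo hi lo' hi' : ℕ) : Decidable (OKc Φv E φ φ' lo hi lo' hi') := by
  unfold OKc; infer_instance

/-- The pair condition of the class check for residue `r = p mod 8`: `OKc` in the real OR in the imaginary coordinate, with the
phase shifts `Φ̄ = −r·E (mod 8)`. [folklore] -/
def PairBarE (r : ZMod 8) (c c' : Fin 3 × Fin 3) (φ φ' : ℤ × ℤ) : Prop :=
  OKc ((-(r * (cd.ER c c' : ZMod 8))).val : ℤ) (cd.ER c c') φ.1 φ'.1 (cd.lo₁ c φ) (cd.hi₁ c φ) (cd.lo₁ c' φ') (cd.hi₁ c' φ') ∨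
  OKc ((-(r * (cd.EI c c' : ZMod 8))).val : ℤ) (cd.EI c c') φ.2 φ'.2 (cd.lo₂ c φ) (cd.hi₂ c φ) (cd.lo₂ c' φ') (cd.hi₂ c' φ')

/-- `PairBarE` is decidable. [folklore] -/
instance (r : ZMod 8) (c c' : Fin 3 × Fin 3) (φ φ' : ℤ × ℤ) : Decidable (cd.PairBarE r c c' φ φ') := by
  unfold PairBarE; infer_instance

/-- **The class check** for residue `r`. [folklore] -/
def ClassOKE (r : ZMod 8) : Prop :=
  (cd.m ≠ 0 ∨ cd.n ≠ 0) ∧ |cd.m| ≤ 3 ∧ |cd.n| ≤ 3 ∧ cd.t ≠ 0 ∧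
    (∀ c, ∀ φ ∈ cd.P c, ((0 ≤ φ.1 ∧ φ.1 < 8) ∧ (0 ≤ φ.2 ∧ φ.2 < 8)) ∧
      cd.lo₁ c φ + cd.hi₁ c φ ≤ 24 ∧ cd.lo₂ c φ + cd.hi₂ c φ ≤ 24) ∧
    (∀ c c', c ≠ c' → |cd.ER c c'| ≤ 3 ∧ |cd.EI c c'| ≤ 3) ∧
    (∀ c c', c ≠ c' → ∀ φ ∈ cd.P c, ∀ φ' ∈ cd.P c', cd.PairBarE r c c' φ φ')

/-- The class check is decidable. [folklore] -/
instance (r : ZMod 8) : Decidable (cd.ClassOKE r) := by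
  unfold ClassOKE; infer_instance

end ClassDataE

/-! ### Arithmetic of `𝔽_p[ω]`: the products `ω^s/8`, `ω^s κ/8` -/

variable {p : ℕ}

/-- All elements of `ZMod 3` are `0, 1, 2`. [folklore] -/
theorem zmod3_cases : ∀ k : ZMod 3, k = 0 ∨ k = 1 ∨ k = 2 := by decide

/-- `ω^s · (x + yω)/… `: the powers of `ω` act on coordinates by `(x, y) ↦ (x, y), (−y, x − y), (y − x, −x)`. [folklore] -/
theorem act_w_mul (s : ZMod 3) (z : Eis p) :
    RCyc.act Eis.w s * z = ⟨(gαR s : ZMod p) * z.re - (gαI s : ZMod p) * z.im,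
      (gαI s : ZMod p) * z.re + ((gαR s : ZMod p) - gαI s) * z.im⟩ := by
  rcases zmod3_cases s with rfl | rfl | rfl
  · rw [RCyc.act_zero, one_mul]
    ext <;> simp [gαR, gαI]
  · have h1 : RCyc.act (Eis.w : Eis p) (1 : ZMod 3) = Eis.w := by
      rw [RCyc.act, ZMod.val_one, pow_one]
    rw [h1]
    ext <;> simp [gαR, gαI, Eis.w]
  · have hv : (2 : ZMod 3).val = 2 := rfl
    have h2 : RCyc.act (Eis.w : Eis p) (2 : ZMod 3) = Eis.w * Eis.w := by
      rw [RCyc.act, hv, pow_two]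
    rw [h2]
    ext <;> simp [gαR, gαI, Eis.w]

/-- An element `g/8` of `𝔽_p` has `8·val = a p + g` with an integer phase `a`. [folklore] -/
theorem eight_val_div [Fact p.Prime] (h8 : (8 : ZMod p) ≠ 0) (g : ℤ) :
    ∃ a : ℤ, 8 * ((((g : ZMod p) * (8 : ZMod p)⁻¹).val : ℕ) : ℤ) = a * p + g := by
  have hdvd : (p : ℤ) ∣ 8 * ((((g : ZMod p) * (8 : ZMod p)⁻¹).val : ℕ) : ℤ) - g := by
    rw [← ZMod.intCast_zmod_eq_zero_iff_dvd]
    push_cast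
    rw [ZMod.natCast_val, ZMod.cast_id', id_eq, mul_comm, mul_assoc, inv_mul_cancel₀ h8, mul_one, sub_self]
  exact ⟨(8 * ((((g : ZMod p) * (8 : ZMod p)⁻¹).val : ℕ) : ℤ) - g) / p, by rw [Int.ediv_mul_cancel hdvd]; ring⟩

/-- Residue of the phase: `8 V = a p + g` forces `a ≡ −p·g (mod 8)` for odd `p`. [folklore] -/
theorem phase_residue {a g V : ℤ} {q : ℤ} (hq : Odd q) (h : 8 * V = a * q + g) :
    ((a : ℤ) : ZMod 8) = -((q : ZMod 8) * (g : ZMod 8)) := by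
  have hsq : ((q * q : ℤ) : ZMod 8) = 1 := by
    obtain ⟨r, hr⟩ := hq
    have h8 : (8 : ℤ) ∣ q * q - 1 := by
      obtain ⟨s, hs⟩ := Int.even_mul_succ_self r
      exact ⟨s, by rw [hr]; linear_combination (4 : ℤ) * hs⟩
    have := (ZMod.intCast_zmod_eq_zero_iff_dvd _ 8).2 h8
    push_cast at this ⊢
    linear_combination this
  have h0 : ((a * q + g : ℤ) : ZMod 8) = 0 := by
    rw [← h, ZMod.intCast_zmod_eq_zero_iff_dvd]
    exact ⟨V, by ring⟩
  push_cast at h0 hsq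
  linear_combination (q : ZMod 8) * h0 - (a : ZMod 8) * hsq

end EisArcs

end Summit.MatrixMultiplication.OmegaCensus
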